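import Summits.Ventures.AbcSig.Conjectures.LevelRaising32L2InstancesCensus3
import Summits.Ventures.AbcSig.Levels.N3296
import Summits.Ventures.AbcSig.Levels.N4064
import Summits.Ventures.AbcSig.Levels.N8416n
import Summits.Ventures.AbcSig.Levels.N11936
import Summits.Ventures.AbcSig.Levels.N12448
import Summits.Ventures.AbcSig.Levels.N3488
import Summits.Ventures.AbcSig.Levels.N3488RB
import Summits.Ventures.AbcSig.Levels.N5792
import Summits.Ventures.AbcSig.Levels.N5792RB
import Summits.Ventures.AbcSig.Levels.N6176
import Summits.Ventures.AbcSig.Levels.N6176RB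

/-!
# Venture AbcSig — `CONJ_LR32_L2` slices at the eight census levels `2⁵ℓ` settled by the tree's PRIME-IDEAL TREE / RE-BASED certificates (part 6)

HONEST FRAMING. Support file of the computation cell `pub-abcsig`, companion of `Conjectures/LevelRaising32L2Instances.lean` (p495825)
and `…Census.lean` … `…Census5.lean` (p500505, p501101, p504586, p505068, p505632). `CONJ_LR32_L2` (p490111) is a CONJECTURE over the
abstract `NewformModel`; nothing here proves it or adds evidence for its content beyond what the level files already certify. GENERATED
MECHANICALLY (HOME/plean/g16/gen16/make_census_slices6.py) from the TREE's level files. The earlier parts read only the norm-form base lists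
(`cp_…_check`) or the plain residual lists of the level summaries and therefore skipped these eight levels («not sliceable from the coarse
certificates», parts 1–5 docstrings); in fact the same tree files already kill every offending (orbit, exponent) pair by a COARSE
certificate of another kind, so no Kraus class table and no cited package is needed:
* NORM-FORM files (hypotheses `DataComplete` + `RefinesCPSymAll`, both COMPUTED — exactly as parts 3–5): `ℓ = 103` (`N3296`: orbits
  `3296.7/.8` have norm-form base `17`; killed at `n = 17` by the in-file prime-ideal TREE certificates `orbit_3296_7_elim_17`,
  `orbit_3296_8_elim_17 : ….Eliminated bs04Allowed 17`, via `NewformModel.not_arisesMod_of_eliminated`), `ℓ = 127` (`N4064`: `.11/.12` at 17,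
  same), `ℓ = 373` (`N11936`: `.10/.11` at 17 by trees; `.12` base `97 ∈ R₃₂(373)` — level raising, excluded by the slice hypothesis, `decide`),
  `ℓ = 389` (`N12448`: `.6/.7` at 17 by trees; `.4` base `89`, `.5` base `53`, both `∈ R₃₂(389)`), `ℓ = 263` (`N8416n`, the `n`-named norm-form
  file: every base `< 17`, vacuous);
* PLAIN files + the tree's RE-BASED supplements `Levels/N…RB.lean` (hypotheses `DataComplete` + the RB file's COMPUTED re-match hypothesis
  `∀ f, M.Matches f orbit_N_k → M.Matches f rb_N_k` for the ONE re-based orbit of the level — two presentations of one eigenvalue system;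
  the rows of record take the same hypothesis through `orbit_N_k_exclStd_n`, here it is used WITHOUT `BS04Package`): `ℓ = 109` (`N3488`:
  `3488.10` at 17 by `rb_3488_10_elim_17`; `3488.7` residual `29 ∈ R₃₂(109)`), `ℓ = 181` (`N5792`: `5792.11` at 31 by `rb_5792_11_elim_31`, at
  `41 ∈ R₃₂(181)` by level raising), `ℓ = 193` (`N6176`: `6176.9` at 23 by `rb_6176_9_elim_23`).
Numbers: 8 levels, 55 + 34 orbits; level-raising sets used: R₃₂(373) ∋ 97 (374² − 14² = 2⁵·3²·5·97), R₃₂(389) ∋ 53, 89 (390² − 34² = 2⁵·53·89),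
R₃₂(109) ∋ 29 (110² − 6² = 2⁵·13·29), R₃₂(181) ∋ 41 (182² − 18² = 2⁵·5²·41). LEDGER AFTER THIS PART: `CONJ_LR32_L2At M ℓ` is proved (modulo the
computed hypotheses of the level files and nothing else) at 62 of the 64 prime levels `2⁵ℓ` whose certified files are in the tree; the two
without a slice are exactly the content-bearing ones — `ℓ = 7` (level 224: pseudo-solution `8 − 7 = 1²`, the rational Frey pair `224.1/.2`,
`Conjectures/LevelRaising32L2InstancesOOS.lean`) and `ℓ = 313` (level 10016: `10016.1` has norm-form base `23 ∉ R₃₂(313) = {2, 3, 5, 17}` and no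
tree certificate — the OPEN INSTANCE (313; 23) of erratum E-LR32-313, `Conjectures/LevelRaising32L2.lean`). WHAT THIS IS NOT: the Kraus-table
part of the premise and the `CongruentToFrey` conclusion stay idle in every proof (vacuous / level-raising slices); the five pseudo-solution
levels `ℓ ∈ {3, 5, 17, 37, 41}` have no level file in the tree and no slice; nothing here is a claim on ABC or any summit.

References: [BS04] M. A. Bennett, C. M. Skinner, Canad. J. Math. 56 (2004) 23–54, Lemma 4.2, Prop. 4.3; [Rib90b] K. Ribet, Progr. Math. 81
(1990) 259–271, Thm 1. Cell records: HOME = run/shared/lean/pub/pub-abcsig/: STRUCTURE.md §6 CONJ-LR32, lead/CONJ-LEAN-SPEC.md,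
plean/g15/README-g15.md (the boundary sentence this part corrects), plean/g16/README-g16.md.
-/

namespace Summit.Ventures.AbcSig.Conjectures

open Summit.Ventures.AbcSig

/-! ## (A) Norm-form levels: norm form off the bases, prime-ideal trees at the base-17 pairs, level raising at the `R₃₂(ℓ)` bases -/

/-- **`CONJ_LR32_L2` at `ℓ = 103` (level `3296 = 2⁵·103`) holds in every model whose level-3296 newforms are the 14 listed orbits of `Levels/N3296.lean`
with the listed characteristic polynomials up to sign** (computed hypotheses `DataComplete`, `RefinesCPSymAll`, nothing else — no cited package; the base-17 pairs `3296_7`, `3296_8` are killed by the in-file prime-ideal tree certificates).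
The premise of the slice is never met at the quantified exponents, so the Kraus-table conjunct of the premise and the `CongruentToFrey`
conclusion stay idle. -/
theorem CONJ_LR32_L2At_103 (M : NewformModel) (hD : M.DataComplete 3296 level3296Orbits) (hCP : M.RefinesCPSymAll 3296 level3296CP) :
    CONJ_LR32_L2At M 103 :=
  CONJ_LR32_L2At_of_not_arisesMod M (by norm_num) fun n hn h17 hnℓ hLR f hA => by
    obtain ⟨o, ho, hfo⟩ := hD f
    simp only [level3296Orbits, List.mem_cons, List.not_mem_nil, or_false] at ho
    rcases ho with rfl | rfl | rfl | rfl | rfl | rfl | rfl | rfl | rfl | rfl | rfl | rfl | rfl | rfl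
    · exact not_arisesMod_of_cpCheck_lr M rfl _ _ _ cp_3296_1_check (by norm_num) (hCP.of_mem (by simp [level3296CP])) hn h17 hnℓ hLR
        (by decide +kernel) f hfo hA
    · exact not_arisesMod_of_cpCheck_lr M rfl _ _ _ cp_3296_2_check (by norm_num) (hCP.of_mem (by simp [level3296CP])) hn h17 hnℓ hLR
        (by decide +kernel) f hfo hA
    · exact not_arisesMod_of_cpCheck_lr M rfl _ _ _ cp_3296_3_check (by norm_num) (hCP.of_mem (by simp [level3296CP])) hn h17 hnℓ hLR
        (by decide +kernel) f hfo hA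
    · exact not_arisesMod_of_cpCheck_lr M rfl _ _ _ cp_3296_4_check (by norm_num) (hCP.of_mem (by simp [level3296CP])) hn h17 hnℓ hLR
        (by decide +kernel) f hfo hA
    · exact not_arisesMod_of_cpCheck_lr M rfl _ _ _ cp_3296_5_check (by simp) (hCP.of_mem (by simp [level3296CP])) hn h17 hnℓ hLR
        (by decide +kernel) f hfo hA
    · exact not_arisesMod_of_cpCheck_lr M rfl _ _ _ cp_3296_6_check (by simp) (hCP.of_mem (by simp [level3296CP])) hn h17 hnℓ hLR
        (by decide +kernel) f hfo hA
    · -- `3296_7`: norm-form bases [3, 17]; the exponent 17 by the prime-ideal tree certificate `orbit_3296_7_elim_17`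
      by_cases hT : n = 17
      · subst hT
        exact M.not_arisesMod_of_eliminated f _ hfo _ bs04Allowed orbit_3296_7_elim_17 (level3296_wellformed _ (by simp [level3296Orbits])) hA
      · exact M.not_arisesMod_of_cpCheck_sym _ _ _ cp_3296_7_check (by norm_num) (hCP.of_mem (by simp [level3296CP])) n hn
          (fun h => by simp only [List.map_cons, List.map_nil, List.mem_cons, List.not_mem_nil, or_false] at h; omega) f hfo hA
    · -- `3296_8`: norm-form bases [3, 17]; the exponent 17 by the prime-ideal tree certificate `orbit_3296_8_elim_17`
      by_cases hT : n = 17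
      · subst hT
        exact M.not_arisesMod_of_eliminated f _ hfo _ bs04Allowed orbit_3296_8_elim_17 (level3296_wellformed _ (by simp [level3296Orbits])) hA
      · exact M.not_arisesMod_of_cpCheck_sym _ _ _ cp_3296_8_check (by norm_num) (hCP.of_mem (by simp [level3296CP])) n hn
          (fun h => by simp only [List.map_cons, List.map_nil, List.mem_cons, List.not_mem_nil, or_false] at h; omega) f hfo hA
    · exact not_arisesMod_of_cpCheck_lr M rfl _ _ _ cp_3296_9_check (by norm_num) (hCP.of_mem (by simp [level3296CP])) hn h17 hnℓ hLR
        (by decide +kernel) f hfo hA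
    · exact not_arisesMod_of_cpCheck_lr M rfl _ _ _ cp_3296_10_check (by norm_num) (hCP.of_mem (by simp [level3296CP])) hn h17 hnℓ hLR
        (by decide +kernel) f hfo hA
    · exact not_arisesMod_of_cpCheck_lr M rfl _ _ _ cp_3296_11_check (by norm_num) (hCP.of_mem (by simp [level3296CP])) hn h17 hnℓ hLR
        (by decide +kernel) f hfo hA
    · exact not_arisesMod_of_cpCheck_lr M rfl _ _ _ cp_3296_12_check (by norm_num) (hCP.of_mem (by simp [level3296CP])) hn h17 hnℓ hLR
        (by decide +kernel) f hfo hA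
    · exact not_arisesMod_of_cpCheck_lr M rfl _ _ _ cp_3296_13_check (by norm_num) (hCP.of_mem (by simp [level3296CP])) hn h17 hnℓ hLR
        (by decide +kernel) f hfo hA
    · exact not_arisesMod_of_cpCheck_lr M rfl _ _ _ cp_3296_14_check (by norm_num) (hCP.of_mem (by simp [level3296CP])) hn h17 hnℓ hLR
        (by decide +kernel) f hfo hA

/-- **`CONJ_LR32_L2` at `ℓ = 127` (level `4064 = 2⁵·127`) holds in every model whose level-4064 newforms are the 12 listed orbits of `Levels/N4064.lean`
with the listed characteristic polynomials up to sign** (computed hypotheses `DataComplete`, `RefinesCPSymAll`, nothing else — no cited package; the base-17 pairs `4064_11`, `4064_12` are killed by the in-file prime-ideal tree certificates).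
The premise of the slice is never met at the quantified exponents, so the Kraus-table conjunct of the premise and the `CongruentToFrey`
conclusion stay idle. -/
theorem CONJ_LR32_L2At_127 (M : NewformModel) (hD : M.DataComplete 4064 level4064Orbits) (hCP : M.RefinesCPSymAll 4064 level4064CP) :
    CONJ_LR32_L2At M 127 :=
  CONJ_LR32_L2At_of_not_arisesMod M (by norm_num) fun n hn h17 hnℓ hLR f hA => by
    obtain ⟨o, ho, hfo⟩ := hD f
    simp only [level4064Orbits, List.mem_cons, List.not_mem_nil, or_false] at ho
    rcases ho with rfl | rfl | rfl | rfl | rfl | rfl | rfl | rfl | rfl | rfl | rfl | rfl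
    · exact not_arisesMod_of_cpCheck_lr M rfl _ _ _ cp_4064_1_check (by norm_num) (hCP.of_mem (by simp [level4064CP])) hn h17 hnℓ hLR
        (by decide +kernel) f hfo hA
    · exact not_arisesMod_of_cpCheck_lr M rfl _ _ _ cp_4064_2_check (by norm_num) (hCP.of_mem (by simp [level4064CP])) hn h17 hnℓ hLR
        (by decide +kernel) f hfo hA
    · exact not_arisesMod_of_cpCheck_lr M rfl _ _ _ cp_4064_3_check (by norm_num) (hCP.of_mem (by simp [level4064CP])) hn h17 hnℓ hLR
        (by decide +kernel) f hfo hA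
    · exact not_arisesMod_of_cpCheck_lr M rfl _ _ _ cp_4064_4_check (by norm_num) (hCP.of_mem (by simp [level4064CP])) hn h17 hnℓ hLR
        (by decide +kernel) f hfo hA
    · exact not_arisesMod_of_cpCheck_lr M rfl _ _ _ cp_4064_5_check (by simp) (hCP.of_mem (by simp [level4064CP])) hn h17 hnℓ hLR
        (by decide +kernel) f hfo hA
    · exact not_arisesMod_of_cpCheck_lr M rfl _ _ _ cp_4064_6_check (by simp) (hCP.of_mem (by simp [level4064CP])) hn h17 hnℓ hLR
        (by decide +kernel) f hfo hA
    · exact not_arisesMod_of_cpCheck_lr M rfl _ _ _ cp_4064_7_check (by norm_num) (hCP.of_mem (by simp [level4064CP])) hn h17 hnℓ hLR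
        (by decide +kernel) f hfo hA
    · exact not_arisesMod_of_cpCheck_lr M rfl _ _ _ cp_4064_8_check (by norm_num) (hCP.of_mem (by simp [level4064CP])) hn h17 hnℓ hLR
        (by decide +kernel) f hfo hA
    · exact not_arisesMod_of_cpCheck_lr M rfl _ _ _ cp_4064_9_check (by norm_num) (hCP.of_mem (by simp [level4064CP])) hn h17 hnℓ hLR
        (by decide +kernel) f hfo hA
    · exact not_arisesMod_of_cpCheck_lr M rfl _ _ _ cp_4064_10_check (by norm_num) (hCP.of_mem (by simp [level4064CP])) hn h17 hnℓ hLR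
        (by decide +kernel) f hfo hA
    · -- `4064_11`: norm-form bases [2, 3, 5, 7, 17]; the exponent 17 by the prime-ideal tree certificate `orbit_4064_11_elim_17`
      by_cases hT : n = 17
      · subst hT
        exact M.not_arisesMod_of_eliminated f _ hfo _ bs04Allowed orbit_4064_11_elim_17 (level4064_wellformed _ (by simp [level4064Orbits])) hA
      · exact M.not_arisesMod_of_cpCheck_sym _ _ _ cp_4064_11_check (by norm_num) (hCP.of_mem (by simp [level4064CP])) n hn
          (fun h => by simp only [List.map_cons, List.map_nil, List.mem_cons, List.not_mem_nil, or_false] at h; omega) f hfo hA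
    · -- `4064_12`: norm-form bases [2, 3, 5, 7, 17]; the exponent 17 by the prime-ideal tree certificate `orbit_4064_12_elim_17`
      by_cases hT : n = 17
      · subst hT
        exact M.not_arisesMod_of_eliminated f _ hfo _ bs04Allowed orbit_4064_12_elim_17 (level4064_wellformed _ (by simp [level4064Orbits])) hA
      · exact M.not_arisesMod_of_cpCheck_sym _ _ _ cp_4064_12_check (by norm_num) (hCP.of_mem (by simp [level4064CP])) n hn
          (fun h => by simp only [List.map_cons, List.map_nil, List.mem_cons, List.not_mem_nil, or_false] at h; omega) f hfo hA

/-- **`CONJ_LR32_L2` at `ℓ = 263` (level `8416 = 2⁵·263`) holds in every model whose level-8416 newforms are the 8 listed orbits of `Levels/N8416n.lean`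
with the listed characteristic polynomials up to sign** (computed hypotheses `DataComplete`, `RefinesCPSymAll`, nothing else — no cited package; vacuous: every certificate base prime is `< 17`).
The premise of the slice is never met at the quantified exponents, so the Kraus-table conjunct of the premise and the `CongruentToFrey`
conclusion stay idle. -/
theorem CONJ_LR32_L2At_263 (M : NewformModel) (hD : M.DataComplete 8416 level8416nOrbits) (hCP : M.RefinesCPSymAll 8416 level8416nCP) :
    CONJ_LR32_L2At M 263 :=
  CONJ_LR32_L2At_of_not_arisesMod M (by norm_num) fun n hn h17 hnℓ hLR f hA => by
    obtain ⟨o, ho, hfo⟩ := hD f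
    simp only [level8416nOrbits, List.mem_cons, List.not_mem_nil, or_false] at ho
    rcases ho with rfl | rfl | rfl | rfl | rfl | rfl | rfl | rfl
    · exact not_arisesMod_of_cpCheck_lr M rfl _ _ _ cp_8416n_1_check (by norm_num) (hCP.of_mem (by simp [level8416nCP])) hn h17 hnℓ hLR
        (by decide +kernel) f hfo hA
    · exact not_arisesMod_of_cpCheck_lr M rfl _ _ _ cp_8416n_2_check (by norm_num) (hCP.of_mem (by simp [level8416nCP])) hn h17 hnℓ hLR
        (by decide +kernel) f hfo hA
    · exact not_arisesMod_of_cpCheck_lr M rfl _ _ _ cp_8416n_3_check (by norm_num) (hCP.of_mem (by simp [level8416nCP])) hn h17 hnℓ hLR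
        (by decide +kernel) f hfo hA
    · exact not_arisesMod_of_cpCheck_lr M rfl _ _ _ cp_8416n_4_check (by norm_num) (hCP.of_mem (by simp [level8416nCP])) hn h17 hnℓ hLR
        (by decide +kernel) f hfo hA
    · exact not_arisesMod_of_cpCheck_lr M rfl _ _ _ cp_8416n_5_check (by norm_num) (hCP.of_mem (by simp [level8416nCP])) hn h17 hnℓ hLR
        (by decide +kernel) f hfo hA
    · exact not_arisesMod_of_cpCheck_lr M rfl _ _ _ cp_8416n_6_check (by norm_num) (hCP.of_mem (by simp [level8416nCP])) hn h17 hnℓ hLR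
        (by decide +kernel) f hfo hA
    · exact not_arisesMod_of_cpCheck_lr M rfl _ _ _ cp_8416n_7_check (by norm_num) (hCP.of_mem (by simp [level8416nCP])) hn h17 hnℓ hLR
        (by decide +kernel) f hfo hA
    · exact not_arisesMod_of_cpCheck_lr M rfl _ _ _ cp_8416n_8_check (by norm_num) (hCP.of_mem (by simp [level8416nCP])) hn h17 hnℓ hLR
        (by decide +kernel) f hfo hA

/-- `a_{373}(32a) = 14` (the tree's naive point count `a32` on `y² = x³ − x`, evaluated ONCE for the slice below). -/
theorem a32_val_373 : a32 373 = 14 := by decide +kernel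

/-- **`CONJ_LR32_L2` at `ℓ = 373` (level `11936 = 2⁵·373`) holds in every model whose level-11936 newforms are the 13 listed orbits of `Levels/N11936.lean`
with the listed characteristic polynomials up to sign** (computed hypotheses `DataComplete`, `RefinesCPSymAll`, nothing else — no cited package; the base-17 pairs `11936_10`, `11936_11` are killed by the in-file prime-ideal tree certificates; base primes [97] ⊆ `R₃₂(373)` = [2, 3, 5, 97] are level-raising primes (excluded by the slice hypothesis; `decide`)).
The premise of the slice is never met at the quantified exponents, so the Kraus-table conjunct of the premise and the `CongruentToFrey`
conclusion stay idle. -/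
theorem CONJ_LR32_L2At_373 (M : NewformModel) (hD : M.DataComplete 11936 level11936Orbits) (hCP : M.RefinesCPSymAll 11936 level11936CP) :
    CONJ_LR32_L2At M 373 :=
  CONJ_LR32_L2At_of_not_arisesMod M (by norm_num) fun n hn h17 hnℓ hLR f hA => by
    obtain ⟨o, ho, hfo⟩ := hD f
    simp only [level11936Orbits, List.mem_cons, List.not_mem_nil, or_false] at ho
    rcases ho with rfl | rfl | rfl | rfl | rfl | rfl | rfl | rfl | rfl | rfl | rfl | rfl | rfl
    · exact not_arisesMod_of_cpCheck_lr M a32_val_373 _ _ _ cp_11936_1_check (by norm_num) (hCP.of_mem (by simp [level11936CP])) hn h17 hnℓ hLR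
        (by decide +kernel) f hfo hA
    · exact not_arisesMod_of_cpCheck_lr M a32_val_373 _ _ _ cp_11936_2_check (by norm_num) (hCP.of_mem (by simp [level11936CP])) hn h17 hnℓ hLR
        (by decide +kernel) f hfo hA
    · exact not_arisesMod_of_cpCheck_lr M a32_val_373 _ _ _ cp_11936_3_check (by norm_num) (hCP.of_mem (by simp [level11936CP])) hn h17 hnℓ hLR
        (by decide +kernel) f hfo hA
    · exact not_arisesMod_of_cpCheck_lr M a32_val_373 _ _ _ cp_11936_4_check (by norm_num) (hCP.of_mem (by simp [level11936CP])) hn h17 hnℓ hLR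
        (by decide +kernel) f hfo hA
    · exact not_arisesMod_of_cpCheck_lr M a32_val_373 _ _ _ cp_11936_5_check (by norm_num) (hCP.of_mem (by simp [level11936CP])) hn h17 hnℓ hLR
        (by decide +kernel) f hfo hA
    · exact not_arisesMod_of_cpCheck_lr M a32_val_373 _ _ _ cp_11936_6_check (by norm_num) (hCP.of_mem (by simp [level11936CP])) hn h17 hnℓ hLR
        (by decide +kernel) f hfo hA
    · exact not_arisesMod_of_cpCheck_lr M a32_val_373 _ _ _ cp_11936_7_check (by norm_num) (hCP.of_mem (by simp [level11936CP])) hn h17 hnℓ hLR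
        (by decide +kernel) f hfo hA
    · exact not_arisesMod_of_cpCheck_lr M a32_val_373 _ _ _ cp_11936_8_check (by simp) (hCP.of_mem (by simp [level11936CP])) hn h17 hnℓ hLR
        (by decide +kernel) f hfo hA
    · exact not_arisesMod_of_cpCheck_lr M a32_val_373 _ _ _ cp_11936_9_check (by simp) (hCP.of_mem (by simp [level11936CP])) hn h17 hnℓ hLR
        (by decide +kernel) f hfo hA
    · -- `11936_10`: norm-form bases [2, 5, 7, 11, 17]; the exponent 17 by the prime-ideal tree certificate `orbit_11936_10_elim_17`
      by_cases hT : n = 17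
      · subst hT
        exact M.not_arisesMod_of_eliminated f _ hfo _ bs04Allowed orbit_11936_10_elim_17 (level11936_wellformed _ (by simp [level11936Orbits])) hA
      · exact M.not_arisesMod_of_cpCheck_sym _ _ _ cp_11936_10_check (by norm_num) (hCP.of_mem (by simp [level11936CP])) n hn
          (fun h => by simp only [List.map_cons, List.map_nil, List.mem_cons, List.not_mem_nil, or_false] at h; omega) f hfo hA
    · -- `11936_11`: norm-form bases [2, 5, 7, 11, 17]; the exponent 17 by the prime-ideal tree certificate `orbit_11936_11_elim_17`
      by_cases hT : n = 17
      · subst hT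
        exact M.not_arisesMod_of_eliminated f _ hfo _ bs04Allowed orbit_11936_11_elim_17 (level11936_wellformed _ (by simp [level11936Orbits])) hA
      · exact M.not_arisesMod_of_cpCheck_sym _ _ _ cp_11936_11_check (by norm_num) (hCP.of_mem (by simp [level11936CP])) n hn
          (fun h => by simp only [List.map_cons, List.map_nil, List.mem_cons, List.not_mem_nil, or_false] at h; omega) f hfo hA
    · exact not_arisesMod_of_cpCheck_lr M a32_val_373 _ _ _ cp_11936_12_check (by norm_num) (hCP.of_mem (by simp [level11936CP])) hn h17 hnℓ hLR
        (by decide +kernel) f hfo hA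
    · exact not_arisesMod_of_cpCheck_lr M a32_val_373 _ _ _ cp_11936_13_check (by norm_num) (hCP.of_mem (by simp [level11936CP])) hn h17 hnℓ hLR
        (by decide +kernel) f hfo hA

/-- `a_{389}(32a) = -34` (the tree's naive point count `a32` on `y² = x³ − x`, evaluated ONCE for the slice below). -/
theorem a32_val_389 : a32 389 = -34 := by decide +kernel

/-- **`CONJ_LR32_L2` at `ℓ = 389` (level `12448 = 2⁵·389`) holds in every model whose level-12448 newforms are the 8 listed orbits of `Levels/N12448.lean`
with the listed characteristic polynomials up to sign** (computed hypotheses `DataComplete`, `RefinesCPSymAll`, nothing else — no cited package; the base-17 pairs `12448_6`, `12448_7` are killed by the in-file prime-ideal tree certificates; base primes [53, 89] ⊆ `R₃₂(389)` = [2, 53, 89] are level-raising primes (excluded by the slice hypothesis; `decide`)).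
The premise of the slice is never met at the quantified exponents, so the Kraus-table conjunct of the premise and the `CongruentToFrey`
conclusion stay idle. -/
theorem CONJ_LR32_L2At_389 (M : NewformModel) (hD : M.DataComplete 12448 level12448Orbits) (hCP : M.RefinesCPSymAll 12448 level12448CP) :
    CONJ_LR32_L2At M 389 :=
  CONJ_LR32_L2At_of_not_arisesMod M (by norm_num) fun n hn h17 hnℓ hLR f hA => by
    obtain ⟨o, ho, hfo⟩ := hD f
    simp only [level12448Orbits, List.mem_cons, List.not_mem_nil, or_false] at ho
    rcases ho with rfl | rfl | rfl | rfl | rfl | rfl | rfl | rfl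
    · exact not_arisesMod_of_cpCheck_lr M a32_val_389 _ _ _ cp_12448_1_check (by simp) (hCP.of_mem (by simp [level12448CP])) hn h17 hnℓ hLR
        (by decide +kernel) f hfo hA
    · exact not_arisesMod_of_cpCheck_lr M a32_val_389 _ _ _ cp_12448_2_check (by norm_num) (hCP.of_mem (by simp [level12448CP])) hn h17 hnℓ hLR
        (by decide +kernel) f hfo hA
    · exact not_arisesMod_of_cpCheck_lr M a32_val_389 _ _ _ cp_12448_3_check (by norm_num) (hCP.of_mem (by simp [level12448CP])) hn h17 hnℓ hLR
        (by decide +kernel) f hfo hA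
    · exact not_arisesMod_of_cpCheck_lr M a32_val_389 _ _ _ cp_12448_4_check (by norm_num) (hCP.of_mem (by simp [level12448CP])) hn h17 hnℓ hLR
        (by decide +kernel) f hfo hA
    · exact not_arisesMod_of_cpCheck_lr M a32_val_389 _ _ _ cp_12448_5_check (by norm_num) (hCP.of_mem (by simp [level12448CP])) hn h17 hnℓ hLR
        (by decide +kernel) f hfo hA
    · -- `12448_6`: norm-form bases [2, 3, 5, 13, 17]; the exponent 17 by the prime-ideal tree certificate `orbit_12448_6_elim_17`
      by_cases hT : n = 17
      · subst hT
        exact M.not_arisesMod_of_eliminated f _ hfo _ bs04Allowed orbit_12448_6_elim_17 (level12448_wellformed _ (by simp [level12448Orbits])) hA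
      · exact M.not_arisesMod_of_cpCheck_sym _ _ _ cp_12448_6_check (by norm_num) (hCP.of_mem (by simp [level12448CP])) n hn
          (fun h => by simp only [List.map_cons, List.map_nil, List.mem_cons, List.not_mem_nil, or_false] at h; omega) f hfo hA
    · -- `12448_7`: norm-form bases [2, 3, 5, 13, 17]; the exponent 17 by the prime-ideal tree certificate `orbit_12448_7_elim_17`
      by_cases hT : n = 17
      · subst hT
        exact M.not_arisesMod_of_eliminated f _ hfo _ bs04Allowed orbit_12448_7_elim_17 (level12448_wellformed _ (by simp [level12448Orbits])) hA
      · exact M.not_arisesMod_of_cpCheck_sym _ _ _ cp_12448_7_check (by norm_num) (hCP.of_mem (by simp [level12448CP])) n hn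
          (fun h => by simp only [List.map_cons, List.map_nil, List.mem_cons, List.not_mem_nil, or_false] at h; omega) f hfo hA
    · exact not_arisesMod_of_cpCheck_lr M a32_val_389 _ _ _ cp_12448_8_check (by norm_num) (hCP.of_mem (by simp [level12448CP])) hn h17 hnℓ hLR
        (by decide +kernel) f hfo hA

/-! ## (B) Plain levels with a re-based supplement: the level summary's residual pairs are level-raising or killed on the RB presentation -/

/-- From a plain level summary `(o.Eliminated bs04Allowed n ∨ X o)` with the callback `X o := "no newform matching o passes the coarse sets
mod a prime above n"`: either way no newform matching `o` passes (glue for the slices below; `NewformModel.not_arisesMod_of_eliminated`). -/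
theorem not_arisesMod_of_eliminated_or (M : NewformModel) {N n : ℕ} {o : OrbitData}
    (h : (∀ e ∈ o.coeffs, e.ell.Prime ∧ e.ell ≠ 2 ∧ ¬ e.ell ∣ N) ∧
      (o.Eliminated bs04Allowed n ∨ ∀ f : M.Form N, M.Matches f o → ¬ M.ArisesMod f n bs04Allowed))
    (f : M.Form N) (hfo : M.Matches f o) : ¬ M.ArisesMod f n bs04Allowed := by
  rcases h.2 with he | hX
  · exact M.not_arisesMod_of_eliminated f o hfo n bs04Allowed he h.1
  · exact hX f hfo

/-- **`CONJ_LR32_L2` at `ℓ = 109` (level `3488 = 2⁵·109`) holds in every model whose level-3488 newforms are the 10 certified orbits of `Levels/N3488.lean`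
and whose newforms matching `orbit_3488_10` also match the re-based data `rb_3488_10`** (computed hypotheses `DataComplete` and the re-match
hypothesis of `Levels/N3488RB.lean`, nothing else — no cited package; the residual pairs `≥ 17` of the level summary are (`3488_10`, 17) (killed on the RE-BASED presentation `rb_3488_10` by `rb_3488_10_elim_17`, `Levels/N3488RB.lean`) and the level-raising exponents [29] ⊆ `R₃₂(109)` = [2, 13, 29] (excluded by the slice hypothesis; `decide`)). The premise of the slice is never met at the
quantified exponents, so the Kraus-table conjunct of the premise and the `CongruentToFrey` conclusion stay idle. -/
theorem CONJ_LR32_L2At_109 (M : NewformModel) (hD : M.DataComplete 3488 level3488Orbits)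
    (hRB : ∀ f : M.Form 3488, M.Matches f orbit_3488_10 → M.Matches f rb_3488_10) :
    CONJ_LR32_L2At M 109 :=
  CONJ_LR32_L2At_of_not_arisesMod M (by norm_num) fun n hn h17 _ hLR f hA => by
    obtain ⟨o, ho, hfo⟩ := hD f
    exact not_arisesMod_of_eliminated_or M (level3488_sieve n hn (by omega)
      (fun o => ∀ f : M.Form 3488, M.Matches f o → ¬ M.ArisesMod f n bs04Allowed)
      (fun h => by simp only [List.mem_cons, List.not_mem_nil, or_false] at h; omega)
      (fun h => by simp only [List.mem_cons, List.not_mem_nil, or_false] at h; omega)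
      (fun h => by simp only [List.mem_cons, List.not_mem_nil, or_false] at h; omega)
      (fun h => by
        simp only [List.mem_cons, List.not_mem_nil, or_false] at h
        rcases h with rfl
        exact (hLR (by decide +kernel)).elim)
      (fun h => by
        simp only [List.mem_cons, List.not_mem_nil, or_false] at h
        rcases h with rfl
        exact fun f' hf' => M.not_arisesMod_of_eliminated f' rb_3488_10 (hRB f' hf') 17 bs04Allowed rb_3488_10_elim_17 rb_3488_10_wellformed) o ho) f hfo hA

/-- **`CONJ_LR32_L2` at `ℓ = 181` (level `5792 = 2⁵·181`) holds in every model whose level-5792 newforms are the 12 certified orbits of `Levels/N5792.lean` (parts N5792P1, N5792P2)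
and whose newforms matching `orbit_5792_11` also match the re-based data `rb_5792_11`** (computed hypotheses `DataComplete` and the re-match
hypothesis of `Levels/N5792RB.lean`, nothing else — no cited package; the residual pairs `≥ 17` of the level summary are (`5792_11`, 31) (killed on the RE-BASED presentation `rb_5792_11` by `rb_5792_11_elim_31`, `Levels/N5792RB.lean`) and the level-raising exponents [41] ⊆ `R₃₂(181)` = [2, 5, 41] (excluded by the slice hypothesis; `decide`)). The premise of the slice is never met at the
quantified exponents, so the Kraus-table conjunct of the premise and the `CongruentToFrey` conclusion stay idle. -/
theorem CONJ_LR32_L2At_181 (M : NewformModel) (hD : M.DataComplete 5792 level5792Orbits)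
    (hRB : ∀ f : M.Form 5792, M.Matches f orbit_5792_11 → M.Matches f rb_5792_11) :
    CONJ_LR32_L2At M 181 :=
  CONJ_LR32_L2At_of_not_arisesMod M (by norm_num) fun n hn h17 _ hLR f hA => by
    obtain ⟨o, ho, hfo⟩ := hD f
    exact not_arisesMod_of_eliminated_or M (level5792_sieve n hn (by omega)
      (fun o => ∀ f : M.Form 5792, M.Matches f o → ¬ M.ArisesMod f n bs04Allowed)
      (fun h => by simp only [List.mem_cons, List.not_mem_nil, or_false] at h; omega)
      (fun h => by simp only [List.mem_cons, List.not_mem_nil, or_false] at h; omega)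
      (fun h => by simp only [List.mem_cons, List.not_mem_nil, or_false] at h; omega)
      (fun h => by simp only [List.mem_cons, List.not_mem_nil, or_false] at h; omega)
      (fun h => by
        simp only [List.mem_cons, List.not_mem_nil, or_false] at h
        rcases h with rfl | rfl
        · exact fun f' hf' => M.not_arisesMod_of_eliminated f' rb_5792_11 (hRB f' hf') 31 bs04Allowed rb_5792_11_elim_31 rb_5792_11_wellformed
        · exact (hLR (by decide +kernel)).elim)
      (fun h => by simp only [List.mem_cons, List.not_mem_nil, or_false] at h; omega) o ho) f hfo hA

/-- **`CONJ_LR32_L2` at `ℓ = 193` (level `6176 = 2⁵·193`) holds in every model whose level-6176 newforms are the 12 certified orbits of `Levels/N6176.lean` (parts N6176P1, N6176P2, N6176P3, N6176P4)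
and whose newforms matching `orbit_6176_9` also match the re-based data `rb_6176_9`** (computed hypotheses `DataComplete` and the re-match
hypothesis of `Levels/N6176RB.lean`, nothing else — no cited package; the residual pairs `≥ 17` of the level summary are (`6176_9`, 23) (killed on the RE-BASED presentation `rb_6176_9` by `rb_6176_9_elim_23`, `Levels/N6176RB.lean`)). The premise of the slice is never met at the
quantified exponents, so the Kraus-table conjunct of the premise and the `CongruentToFrey` conclusion stay idle. -/
theorem CONJ_LR32_L2At_193 (M : NewformModel) (hD : M.DataComplete 6176 level6176Orbits)
    (hRB : ∀ f : M.Form 6176, M.Matches f orbit_6176_9 → M.Matches f rb_6176_9) :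
    CONJ_LR32_L2At M 193 :=
  CONJ_LR32_L2At_of_not_arisesMod M (by norm_num) fun n hn h17 _ _ f hA => by
    obtain ⟨o, ho, hfo⟩ := hD f
    exact not_arisesMod_of_eliminated_or M (level6176_sieve n hn (by omega)
      (fun o => ∀ f : M.Form 6176, M.Matches f o → ¬ M.ArisesMod f n bs04Allowed)
      (fun h => by simp only [List.mem_cons, List.not_mem_nil, or_false] at h; omega)
      (fun h => by simp only [List.mem_cons, List.not_mem_nil, or_false] at h; omega)
      (fun h => by simp only [List.mem_cons, List.not_mem_nil, or_false] at h; omega)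
      (fun h => by simp only [List.mem_cons, List.not_mem_nil, or_false] at h; omega)
      (fun h => by
        simp only [List.mem_cons, List.not_mem_nil, or_false] at h
        rcases h with rfl
        exact fun f' hf' => M.not_arisesMod_of_eliminated f' rb_6176_9 (hRB f' hf') 23 bs04Allowed rb_6176_9_elim_23 rb_6176_9_wellformed)
      (fun h => by simp only [List.mem_cons, List.not_mem_nil, or_false] at h; omega) o ho) f hfo hA

end Summit.Ventures.AbcSig.Conjectures
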